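import Mathlib.Algebra.CharP.Algebra
import Mathlib.RingTheory.Localization.Basic
import Mathlib.RingTheory.Localization.Integer
import Literature.NumberTheory.GaloisCohomology.PBasis
import HarnessLib

/-!
# `p`-bases localise and are transported by ring isomorphisms

Let `R` be a commutative ring of prime characteristic `p` with a finite `p`-basis `t : ι → R`
(`IsPBasis p t`, file `PBasis.lean`: the `p`-monomials `t^α = ∏ i, t i ^ α i`, `α : ι → Fin p`, form an
`R`-basis of the Frobenius twist `FrobeniusTwist p R R`, i.e. every `x : R` is uniquely `∑_α c_α ^ p * t^α`).
We prove:

* `isPBasis_iff` — the UNTWISTED criterion: `t` is a `p`-basis iff the only `p`-expansion of `0` is the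
  trivial one and every element has a `p`-expansion;
* `IsPBasis.map_ringEquiv` — a ring isomorphism `e : R ≃+* S` carries `p`-bases to `p`-bases;
* `IsPBasis.localization` — **`p`-bases localise**: if `S` is a localization of `R` at a submonoid `M`
  (`[IsLocalization M S]`, `S` of characteristic `p`), then `i ↦ algebraMap R S (t i)` is a `p`-basis of `S`.
  Spanning: `x / s = (1/s)^p · (x s^{p-1})` and `x s^{p-1}` expands in `R`; independence: clear denominators,
  push the relation to `R` (up to a factor `u ∈ M`, absorbed as `u^p = u^{p-1} · u`), and use independence in `R`;
* `charP_of_algebra_of_prime` — a nontrivial algebra over `R` has characteristic `p` (so the hypothesis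
  `[CharP S p]` holds for every localization at a submonoid avoiding `0`), and the special case
  `IsPBasis.fractionRing` of the fraction field of a domain.

These are the standard permanence properties of `p`-bases (Matsumura, §26, for fields; Grothendieck,
EGA 0_IV 21.1–21.2, in general), needed to pass a `p`-basis of a ring `T` to `T_P`, `T_x` and `Frac T`.

## References

* H. Matsumura, *Commutative Ring Theory*, CUP 1986, §26 (p-bases, Thm. 26.5–26.8). [Matsumura1987]
-/

noncomputable section

open scoped BigOperators

namespace Literature.NumberTheory.GaloisCohomology

universe u v w

variable (p : ℕ) [hp : Fact p.Prime] {R : Type u} [CommRing R] [CharP R p] {ι : Type v} [Fintype ι]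

/-! ### `p`-expansions and the untwisted criterion -/

/-- A twisted linear combination of `p`-monomials is a `p`-expansion:
`∑_α d_α • t^α = of (∑_α d_α ^ p * t^α)` in `FrobeniusTwist p R R`. [folklore] -/
theorem sum_smul_pMonomialTwist [DecidableEq ι] (t : ι → R) (d : (ι → Fin p) → R) :
    ∑ α, d α • pMonomialTwist p t α = FrobeniusTwist.of p R (∑ α, d α ^ p * pMonomial p t α) := by
  rw [map_sum]
  refine Finset.sum_congr rfl fun α _ => ?_
  rw [pMonomialTwist, FrobeniusTwist.smul_of_eq_of_pow_mul]

/-- **Untwisted criterion for a `p`-basis**: `t` is a `p`-basis of `R` iff (i) the only `p`-expansion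
`∑_α d_α ^ p * t^α = 0` of zero is the trivial one and (ii) every `x : R` has a `p`-expansion
`x = ∑_α c_α ^ p * t^α`. [cite: Matsumura1987, §26] -/
theorem isPBasis_iff [DecidableEq ι] (t : ι → R) :
    IsPBasis p t ↔
      (∀ d : (ι → Fin p) → R, ∑ α, d α ^ p * pMonomial p t α = 0 → ∀ α, d α = 0) ∧
        ∀ x : R, ∃ c : (ι → Fin p) → R, ∑ α, c α ^ p * pMonomial p t α = x := by
  constructor
  · intro h
    refine ⟨fun d hd => ?_, fun x => ?_⟩
    · have hli := h.linearIndependent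
      rw [Fintype.linearIndependent_iff] at hli
      exact hli d (by rw [sum_smul_pMonomialTwist, hd, map_zero])
    · have hx : FrobeniusTwist.of p R x ∈ Submodule.span R (Set.range (pMonomialTwist p t)) := by
        rw [h.span_eq_top]
        exact Submodule.mem_top
      obtain ⟨c, hc⟩ := (Submodule.mem_span_range_iff_exists_fun R).1 hx
      refine ⟨c, (FrobeniusTwist.of p R).injective ?_⟩
      rw [← sum_smul_pMonomialTwist, hc]
  · rintro ⟨hind, hspan⟩
    refine ⟨?_, ?_⟩
    · rw [Fintype.linearIndependent_iff]
      intro d hd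
      refine hind d ((FrobeniusTwist.of p R).injective ?_)
      rw [← sum_smul_pMonomialTwist, hd, map_zero]
    · rw [eq_top_iff]
      refine (Submodule.top_le_span_range_iff_forall_exists_fun R).2 fun y => ?_
      obtain ⟨c, hc⟩ := hspan ((FrobeniusTwist.of p R).symm y)
      exact ⟨c, by rw [sum_smul_pMonomialTwist, hc, AddEquiv.apply_symm_apply]⟩

omit hp [CharP R p] in
/-- `p`-monomials are preserved by multiplicative maps: `(f ∘ t)^α = f (t^α)`. [folklore] -/
theorem pMonomial_map {S : Type w} [CommRing S] {F : Type*} [FunLike F R S] [MonoidHomClass F R S]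
    (f : F) (t : ι → R) (α : ι → Fin p) :
    pMonomial p (fun i => f (t i)) α = f (pMonomial p t α) := by
  simp only [pMonomial, map_prod, map_pow]

omit hp [CharP R p] in
/-- Ring homomorphisms map `p`-expansions to `p`-expansions:
`f (∑_α c_α ^ p * t^α) = ∑_α (f c_α) ^ p * (f ∘ t)^α`. [folklore] -/
theorem map_sum_pow_mul_pMonomial [DecidableEq ι] {S : Type w} [CommRing S] {F : Type*} [FunLike F R S]
    [RingHomClass F R S] (f : F) (t : ι → R) (c : (ι → Fin p) → R) :
    f (∑ α, c α ^ p * pMonomial p t α) = ∑ α, f (c α) ^ p * pMonomial p (fun i => f (t i)) α := by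
  rw [map_sum]
  refine Finset.sum_congr rfl fun α _ => ?_
  rw [map_mul, map_pow, pMonomial_map]

omit [CharP R p] in
/-- A nontrivial algebra `A` over a ring `R` of PRIME characteristic `p` has characteristic `p` (the
characteristic of `A` divides `p` and is not `1`) — e.g. any localization of `R` at a submonoid not
containing `0`. [folklore] -/
theorem charP_of_algebra_of_prime [CharP R p] (A : Type w) [Semiring A] [Nontrivial A] [Algebra R A] :
    CharP A p :=
  (CharP.charP_iff_prime_eq_zero hp.out).2 (by
    rw [← map_natCast (algebraMap R A), CharP.cast_eq_zero, map_zero])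

/-! ### Transport along ring isomorphisms and localization -/

namespace IsPBasis

variable {p} {t : ι → R}

/-- **`p`-bases are transported by ring isomorphisms**: if `t` is a `p`-basis of `R` and `e : R ≃+* S`,
then `i ↦ e (t i)` is a `p`-basis of `S`. [folklore] -/
theorem map_ringEquiv {S : Type w} [CommRing S] [CharP S p] (h : IsPBasis p t) (e : R ≃+* S) :
    IsPBasis p (fun i => e (t i)) := by
  classical
  rw [isPBasis_iff] at h ⊢
  obtain ⟨hind, hspan⟩ := h
  refine ⟨fun d hd α => ?_, fun y => ?_⟩
  · have key : e (∑ β, e.symm (d β) ^ p * pMonomial p t β) = 0 := by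
      rw [map_sum_pow_mul_pMonomial, ← hd]
      exact Finset.sum_congr rfl fun β _ => by rw [RingEquiv.apply_symm_apply]
    exact EmbeddingLike.map_eq_zero_iff.1 (hind _ (EmbeddingLike.map_eq_zero_iff.1 key) α)
  · obtain ⟨c, hc⟩ := hspan (e.symm y)
    exact ⟨fun α => e (c α), by rw [← map_sum_pow_mul_pMonomial, hc, RingEquiv.apply_symm_apply]⟩

/-- **`p`-bases localise.**  If `t` is a `p`-basis of `R` and `S` is a localization of `R` at a submonoid
`M` (of characteristic `p`, which is automatic as soon as `S` is nontrivial, `charP_of_algebra_of_prime`),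
then `i ↦ algebraMap R S (t i)` is a `p`-basis of `S`.  Spanning: `z = x/s = (1/s)^p · (x s^{p-1})`, and
`x s^{p-1} = ∑ c_α^p t^α` in `R`; independence: a relation `∑ d_α^p t^α = 0` in `S` with a common denominator
`d_α = c_α / b` gives `algebraMap (∑ c_α^p t^α) = 0`, hence `u ∑ c_α^p t^α = 0` for some `u ∈ M`, hence
`∑ (u c_α)^p t^α = 0`, so `u c_α = 0` and `d_α = 0`. [cite: Matsumura1987, §26] -/
theorem localization {S : Type w} [CommRing S] [Algebra R S] (M : Submonoid R) [IsLocalization M S]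
    [CharP S p] (h : IsPBasis p t) : IsPBasis p (fun i => algebraMap R S (t i)) := by
  classical
  have hp0 : p ≠ 0 := hp.out.ne_zero
  rw [isPBasis_iff] at h ⊢
  obtain ⟨hind, hspan⟩ := h
  refine ⟨fun d hd α => ?_, fun z => ?_⟩
  · -- clear denominators: `algebraMap (c β) = b • d β` for a common `b ∈ M`
    obtain ⟨b, hb⟩ := IsLocalization.exist_integer_multiples_of_finite M d
    have hb' : ∀ β, ∃ c : R, algebraMap R S c = (b : R) • d β := fun β => hb β
    choose c hc using hb'
    have hsum : algebraMap R S (∑ β, c β ^ p * pMonomial p t β) = 0 := by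
      rw [map_sum_pow_mul_pMonomial]
      calc ∑ β, algebraMap R S (c β) ^ p * pMonomial p (fun i => algebraMap R S (t i)) β
          = ∑ β, algebraMap R S b ^ p * (d β ^ p * pMonomial p (fun i => algebraMap R S (t i)) β) :=
            Finset.sum_congr rfl fun β _ => by rw [hc, Algebra.smul_def, mul_pow, mul_assoc]
        _ = 0 := by rw [← Finset.mul_sum, hd, mul_zero]
    obtain ⟨m, hm⟩ := (IsLocalization.map_eq_zero_iff M S _).1 hsum
    -- absorb the torsion factor `m`: `∑ (m c_β)^p t^β = m^{p-1} (m ∑ c_β^p t^β) = 0`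
    have hsum' : ∑ β, ((m : R) * c β) ^ p * pMonomial p t β = 0 := by
      calc ∑ β, ((m : R) * c β) ^ p * pMonomial p t β
          = (m : R) ^ p * ∑ β, c β ^ p * pMonomial p t β := by
            rw [Finset.mul_sum]
            exact Finset.sum_congr rfl fun β _ => by rw [mul_pow, mul_assoc]
        _ = 0 := by rw [← pow_sub_one_mul hp0, mul_assoc, hm, mul_zero]
    have hmc : (m : R) * c α = 0 := hind _ hsum' α
    have h1 : algebraMap R S (c α) = 0 := by
      have h2 := congrArg (algebraMap R S) hmc
      rw [map_mul, map_zero] at h2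
      exact (IsLocalization.map_units S m).mul_right_eq_zero.1 h2
    rw [hc, Algebra.smul_def] at h1
    exact (IsLocalization.map_units S b).mul_right_eq_zero.1 h1
  · -- write `z = x / s = v^p * (x * s^(p-1))` with `v * s = 1`, and expand `x * s^(p-1)` in `R`
    obtain ⟨⟨x, s⟩, hxs⟩ := IsLocalization.surj M z
    dsimp only at hxs
    obtain ⟨c, hc⟩ := hspan (x * (s : R) ^ (p - 1))
    obtain ⟨v, hv⟩ := (IsLocalization.map_units S s).exists_left_inv
    refine ⟨fun α => v * algebraMap R S (c α), ?_⟩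
    calc ∑ α, (v * algebraMap R S (c α)) ^ p * pMonomial p (fun i => algebraMap R S (t i)) α
        = v ^ p * ∑ α, algebraMap R S (c α) ^ p * pMonomial p (fun i => algebraMap R S (t i)) α := by
          rw [Finset.mul_sum]
          exact Finset.sum_congr rfl fun α _ => by rw [mul_pow, mul_assoc]
      _ = v ^ p * (z * algebraMap R S s ^ p) := by
          rw [← map_sum_pow_mul_pMonomial, hc, map_mul, map_pow, ← hxs, mul_assoc z,
            mul_pow_sub_one hp0]
      _ = z * (v * algebraMap R S s) ^ p := by rw [mul_pow, mul_left_comm]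
      _ = z := by rw [hv, one_pow, mul_one]

/-- **A `p`-basis of a domain is a `p`-basis of its fraction field.** [cite: Matsumura1987, §26] -/
theorem fractionRing [IsDomain R] (h : IsPBasis p t) :
    IsPBasis p (fun i => algebraMap R (FractionRing R) (t i)) :=
  h.localization (nonZeroDivisors R)

/-- A `p`-basis of `R` is a `p`-basis of any fraction field `K` of `R` (`[IsFractionRing R K]`, `K` of
characteristic `p`). [cite: Matsumura1987, §26] -/
theorem isFractionRing {K : Type w} [CommRing K] [Algebra R K] [IsFractionRing R K] [CharP K p]
    (h : IsPBasis p t) : IsPBasis p (fun i => algebraMap R K (t i)) :=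
  h.localization (nonZeroDivisors R)

end IsPBasis

end Literature.NumberTheory.GaloisCohomology

end
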